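import Literature.Geometry.Lorentzian.InverseMeanCurvatureFlowRegularised
import Literature.Geometry.Lorentzian.InverseMeanCurvatureFlowInitialValue
import HarnessLib

/-!
# Inverse mean curvature flow I — proofs: the Smooth Flow Lemma 2.3 in functional form —
# classical (sub/super)solutions of `div(∇u/|∇u|) = |∇u|` are weak (sub/super)solutions

Huisken–Ilmanen, J. Differential Geom. 59 (2001), §2, **Smooth Flow Lemma 2.3** (p. 23 of the
printed paper): *"Let `(N_t)_{c≤t<d}` be a smooth family of surfaces of positive mean curvature
that solves (∗) classically. Let `u = t` on `N_t` … Then for `c ≤ t < d`, `E_t` minimizes `J_u` in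
`E_d ∖ Ē_c`."* — with the proof *"The exterior normal, defined by `ν_u := ∇u/|∇u|`, is a smooth
unit vector field on `Ω` with `div ν_u = H_{N_t} = |∇u| > 0`. Using `ν_u` as a calibration, by the
divergence theorem …"*. By Lemma 1.1 the conclusion is that `u` is a weak solution of (1.5) on the
foliated region. This file proves the statement directly in the functional (level-set) form of
`InverseMeanCurvatureFlow.lean`, together with its one-sided versions, which are the source's
notion of *smooth sub- and supersolutions* (used in the proof of Thm. 3.1, step 2: "`λ log s` is a
smooth subsolution of (1.5) on `∂U_L × [C, ∞)`", and in Remark 1 after Thm. 3.1: "`v = C log|x|`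
in the asymptotic region"):

Let `W ⊆ X` be open, `u ∈ C²(X)` with `ψ := |∇u| > 0` and `ψ ∈ C¹` on `W`, and put
`E := ψ Δ_h u − h⁻¹(dψ, du)` on `W`, so that the mean curvature of the level sets is
`H = div(∇u/ψ) = E/ψ²` and the level-set equation (∗∗) `div(∇u/|∇u|) = |∇u|` reads `E = ψ³`.

* `imcfEnergy_add_setIntegral_le_of_smooth` — **the calibration inequality**: for every locally
  Lipschitz competitor `v` and compact `K ⊆ W` containing `{v ≠ u} ∩ W`,
  `J_u^K(u) + ∫_K (v − u) ψ⁻² (ψ³ − E) dμ_h ≤ J_u^K(v)`. Proof as in loc. cit. (and as in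
  `imcfEnergy_le_add_of_regularised`, `InverseMeanCurvatureFlowRegularised.lean`, with `ε = 0`):
  a.e. `|∇v| ≥ h⁻¹(dv, du)/ψ = |∇u| + h⁻¹(d(v − u), du)/ψ` (Cauchy–Schwarz), and Green's identity
  against the Lipschitz test function `(v − u)/ψ`
  (`integral_mul_dalembertian_eq_neg_integral_innerDual_of_isLocLipschitzOn`) gives
  `∫ h⁻¹(d(v − u), du)/ψ = −∫ (v − u) E/ψ²`;
* `isWeakSolution_of_smooth` — **Lemma 2.3**: `E = ψ³` on `W` ⟹ `u` is a weak solution of (∗∗)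
  on `W`;
* `isWeakSubsolution_of_smooth` — `E ≥ ψ³` on `W` (level sets of mean curvature `H ≥ |∇u|`, "the
  surfaces are moving faster than by inverse mean curvature", §6) ⟹ `u` is a weak subsolution on
  `W`;
* `isWeakSupersolution_of_smooth` — `E ≤ ψ³` on `W` ⟹ `u` is a weak supersolution on `W`;

and the tools `IsLocLipschitzOn.inv_of_pos` (reciprocals of locally Lipschitz functions positive
on an open set) and `mvfderiv_div_apply_of_ne` (quotient rule when the denominator is nonzero near
the point only).

The same statements with `u` only of class `C²` *on `W`* (`imcfEnergy_add_setIntegral_le_of_smoothOn`,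
`isWeakSolution_of_smoothOn`, `isWeakSubsolution_of_smoothOn`, `isWeakSupersolution_of_smoothOn`) —
the form needed for functions singular off `W` such as `C log |x|` or `λ log s` — follow by
globalising `u` near the compact set `K` of a given competitor with a smooth cut-off (all
quantities in (1.5) and in the equation are local).

Everything is proved; there are no definitions and no named facts.

## References

* G. Huisken, T. Ilmanen, *The inverse mean curvature flow and the Riemannian Penrose
  inequality*, J. Differential Geom. 59 (2001) 353–437: §2, Smooth Flow Lemma 2.3 and its proof
  (p. 23); §1, Lemma 1.1; §3, proof of Thm. 3.1, step 2, and Remark 1 after Thm. 3.1.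
-/

noncomputable section

open Bundle Set Function Filter Manifold MeasureTheory
open scoped Manifold ContDiff Topology ENNReal NNReal

namespace Literature.Geometry.Lorentzian

open PseudoRiemannianMetric

variable {X : Type*} [TopologicalSpace X] [ChartedSpace E3 X] [IsManifold (𝓡 3) ∞ X]
  (h : ContMDiffRiemannianMetric (𝓡 3) ∞ E3 (TangentSpace (𝓡 3) : X → Type _))

/-! ### Tools: reciprocals and the quotient rule under local hypotheses -/

section Tools

omit [IsManifold (𝓡 3) ∞ X] in
set_option backward.isDefEq.respectTransparency false in
/-- **Quotient rule, applied form, for a denominator nonzero near the point**: if `f, ψ` are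
differentiable at `x`, `ψ` is continuous at `x` and `ψ x ≠ 0`, then
`d(f/ψ)_x(v) = df_x(v)/ψ(x) − f(x) dψ_x(v)/ψ(x)²` (reduce to `mvfderiv_div_apply` for the
function `ψ'` equal to `ψ` near `x` and to `1` where `ψ = 0`). [folklore] -/
theorem mvfderiv_div_apply_of_ne {f ψ : X → ℝ} {x : X} (hf : MDifferentiableAt (𝓡 3) 𝓘(ℝ, ℝ) f x)
    (hψ : MDifferentiableAt (𝓡 3) 𝓘(ℝ, ℝ) ψ x) (hψc : ContinuousAt ψ x) (hne : ψ x ≠ 0)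
    (v : TangentSpace (𝓡 3) x) :
    mvfderiv (𝓡 3) (fun y ↦ f y * (ψ y)⁻¹) x v =
      mvfderiv (𝓡 3) f x v / ψ x - f x * mvfderiv (𝓡 3) ψ x v / ψ x ^ 2 := by
  classical
  set ψ' : X → ℝ := fun y ↦ if ψ y = 0 then 1 else ψ y with hψ'
  have hev : ψ' =ᶠ[𝓝 x] ψ := by
    filter_upwards [hψc.preimage_mem_nhds (isOpen_compl_singleton.mem_nhds hne)] with y hy
    have hy' : ψ y ≠ 0 := hy
    simp [hψ', hy']
  have hne' : ∀ y, ψ' y ≠ 0 := fun y ↦ by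
    by_cases hy : ψ y = 0 <;> simp [hψ', hy]
  have hψ'd : MDifferentiableAt (𝓡 3) 𝓘(ℝ, ℝ) ψ' x := hψ.congr_of_eventuallyEq hev
  have h1 : mvfderiv (𝓡 3) (fun y ↦ f y * (ψ y)⁻¹) x = mvfderiv (𝓡 3) (fun y ↦ f y * (ψ' y)⁻¹) x := by
    refine mvfderiv_congr_of_eventuallyEq ?_
    filter_upwards [hev] with y hy
    rw [hy]
  have h2 : mvfderiv (𝓡 3) ψ' x = mvfderiv (𝓡 3) ψ x := mvfderiv_congr_of_eventuallyEq hev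
  have h3 : ψ' x = ψ x := hev.eq_of_nhds
  rw [h1, mvfderiv_div_apply hf hψ'd hne' v, h2, h3]

variable [T2Space X] [LocallyCompactSpace X]

/-- **Reciprocals of locally Lipschitz functions positive on an open set are locally Lipschitz
there**: near each point of `W` the function is bounded below by a positive constant, and
`IsLocLipschitzOn.inv_of_le` applies on that neighbourhood. [folklore] -/
theorem IsLocLipschitzOn.inv_of_pos {ψ : X → ℝ} {W : Set X} (hW : IsOpen W)
    (hψ : IsLocLipschitzOn h ψ W) (hpos : ∀ x ∈ W, 0 < ψ x) :
    IsLocLipschitzOn h (fun x ↦ (ψ x)⁻¹) W := by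
  letI : RiemannianBundle (fun x : X ↦ TangentSpace (𝓡 3) x) :=
    ⟨h.toContinuousRiemannianMetric.toRiemannianMetric⟩
  letI : PseudoEMetricSpace X := .ofRiemannianMetric (𝓡 3) X
  have hψc : ContinuousOn ψ W := hψ.continuousOn h
  refine isLocLipschitzOn_of_forall_exists_nhds h fun x hx ↦ ?_
  -- a neighbourhood `V ⊆ W` of `x` on which `ψ ≥ ψ x / 2`
  set ε : ℝ := ψ x / 2 with hε
  have hε0 : 0 < ε := by rw [hε]; linarith [hpos x hx]
  have hV : {y | ε < ψ y} ∩ W ∈ 𝓝 x := by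
    have h1 : W ∩ ψ ⁻¹' Ioi ε ∈ 𝓝 x := by
      refine (hψc.isOpen_inter_preimage hW isOpen_Ioi).mem_nhds ⟨hx, ?_⟩
      show ε < ψ x
      rw [hε]; linarith [hpos x hx]
    filter_upwards [h1] with y hy using ⟨hy.2, hy.1⟩
  set V : Set X := {y | ε < ψ y} ∩ W with hVdef
  have hVo : IsOpen V := by
    have : IsOpen (W ∩ ψ ⁻¹' Ioi ε) := hψc.isOpen_inter_preimage hW isOpen_Ioi
    have hVeq : V = W ∩ ψ ⁻¹' Ioi ε := by
      ext y; simp only [hVdef, mem_inter_iff, mem_setOf_eq, mem_preimage, mem_Ioi]; tauto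
    rw [hVeq]; exact this
  -- the truncated function `max ψ ε` agrees with `ψ` on `V` and is `≥ ε` everywhere
  have hψV : IsLocLipschitzOn h (fun y ↦ max (ψ y) ε) V :=
    (hψ.mono h inter_subset_right).sup h (isLocLipschitzOn_const h ε V)
  have hinvV : IsLocLipschitzOn h (fun y ↦ (max (ψ y) ε)⁻¹) V :=
    hψV.inv_of_le h hε0 (fun y ↦ le_max_right _ _)
  obtain ⟨K, t, ht, hK⟩ := (show LocallyLipschitzOn V (fun y ↦ (max (ψ y) ε)⁻¹) from hinvV)
    (show x ∈ V from mem_of_mem_nhds hV)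
  rw [hVo.nhdsWithin_eq (mem_of_mem_nhds hV)] at ht
  refine ⟨K, t ∩ V, inter_mem ht hV, fun y hy z hz ↦ ?_⟩
  have hy' : max (ψ y) ε = ψ y := max_eq_left hy.2.1.le
  have hz' : max (ψ z) ε = ψ z := max_eq_left hz.2.1.le
  have := hK hy.1 hz.1
  simp only [hy', hz'] at this
  exact this

end Tools

/-! ### The calibration inequality and the Smooth Flow Lemma -/

section Calibration

variable [T2Space X] [LocallyCompactSpace X] [MeasurableSpace X] [BorelSpace X]
  [SecondCountableTopology X] [(ofRiemannian h).HasLeviCivita]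

set_option backward.isDefEq.respectTransparency false in
/-- **Calibration inequality for classical solutions (Huisken–Ilmanen's Lemma 2.3, quantitative
form).** Let `W ⊆ X` be open, `u ∈ C²(X)`, `ψ = |∇u|` (pointwise) with `ψ > 0` and `ψ ∈ C¹` on
`W`, and `E := ψ Δ_h u − h⁻¹(dψ, du)` (so that the level sets `{u = t} ∩ W` have mean curvature
`H = div(∇u/|∇u|) = E/ψ²`). Then for every `v` locally Lipschitz on `W` and every compact `K ⊆ W`
containing `{v ≠ u} ∩ W`,

  `J_u^K(u) + ∫_K (v − u) ψ⁻² (ψ³ − E) dμ_h ≤ J_u^K(v)`.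

Proof ("using `ν_u = ∇u/|∇u|` as a calibration, by the divergence theorem"): a.e. on `K`,
`|∇v| ≥ h⁻¹(dv, du)/ψ = |∇u| + h⁻¹(d(v − u), du)/ψ` (Cauchy–Schwarz and `h⁻¹(du, du) = ψ²`);
Green's identity against the compactly supported Lipschitz function `(v − u)/ψ`
(`integral_mul_dalembertian_eq_neg_integral_innerDual_of_isLocLipschitzOn`) and the quotient rule
give `∫ h⁻¹(d(v − u), du)/ψ = −∫ (v − u) E/ψ²`; and `J_u^K(v) − J_u^K(u) = ∫_K (|∇v| − |∇u|) +
(v − u)|∇u|`. [cite: HuiskenIlmanenIMCF2001, §2 Lemma 2.3 and its proof] -/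
theorem imcfEnergy_add_setIntegral_le_of_smooth {W : Set X} (hW : IsOpen W) {u : X → ℝ}
    (hu : ContMDiff (𝓡 3) 𝓘(ℝ, ℝ) 2 u) {ψ : X → ℝ} (hψ : ∀ x, ψ x = gradNorm h u x)
    (hψpos : ∀ x ∈ W, 0 < ψ x) (hψ1 : ContMDiffOn (𝓡 3) 𝓘(ℝ, ℝ) 1 ψ W)
    {v : X → ℝ} (hv : IsLocLipschitzOn h v W) {K : Set X} (hK : IsCompact K) (hKW : K ⊆ W)
    (hvK : {x | x ∈ W ∧ v x ≠ u x} ⊆ K) :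
    imcfEnergy h u K u + ∫ x in K, (v x - u x) * (ψ x)⁻¹ ^ 2 *
        (ψ x ^ 3 - (ψ x * (ofRiemannian h).dalembertian u x -
          (ofRiemannian h).innerDual x (mvfderiv (𝓡 3) ψ x).toLinearMap
            (mvfderiv (𝓡 3) u x).toLinearMap)) ∂riemannianMeasure h ≤
      imcfEnergy h u K v := by
  classical
  haveI : IsFiniteMeasureOnCompacts (riemannianMeasure h) :=
    ⟨fun K hK ↦ riemannianVolume_lt_top_of_isCompact_holds h le_rfl hK⟩
  set μ := riemannianMeasure h with hμ
  have hu1 : ContMDiff (𝓡 3) 𝓘(ℝ, ℝ) 1 u := hu.of_le (by norm_num)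
  have huW : IsLocLipschitzOn h u W := isLocLipschitzOn_of_contMDiff' h hu1 W
  -- (0) `ψ = |∇u| ≥ 0`, continuous; `ψ ≠ 0` on `W`
  have hg0 : ∀ x, 0 ≤ gradNorm h u x := fun x ↦ gradNorm_nonneg h u x
  have hψne : ∀ x ∈ W, ψ x ≠ 0 := fun x hx ↦ (hψpos x hx).ne'
  have hψfun : ψ = gradNorm h u := funext hψ
  have hgc : Continuous (gradNorm h u) := by
    have h1 := continuous_innerDual_mvfderiv (ofRiemannian h) hu1 hu1
    have h2 : gradNorm h u = fun x ↦ Real.sqrt ((ofRiemannian h).innerDual x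
        (mvfderiv (𝓡 3) u x).toLinearMap (mvfderiv (𝓡 3) u x).toLinearMap) := rfl
    rw [h2]
    exact Real.continuous_sqrt.comp h1
  have hψc : Continuous ψ := by rw [hψfun]; exact hgc
  -- (1) the Lipschitz functions `f = 1_W (v - u)` and `w = f / ψ`
  set f : X → ℝ := W.indicator fun x ↦ v x - u x with hf
  have hfW : ∀ x ∈ W, f x = v x - u x := fun x hx ↦ by rw [hf, indicator_of_mem hx]
  have hfK0 : ∀ x ∉ K, f x = 0 := by
    intro x hx
    by_cases hxW : x ∈ W
    · rw [hfW x hxW]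
      have : v x = u x := by by_contra hne; exact hx (hvK ⟨hxW, hne⟩)
      rw [this, sub_self]
    · rw [hf, indicator_of_notMem hxW]
  have hftsupp : tsupport f ⊆ K :=
    closure_minimal (fun x hx ↦ by_contra fun hxK ↦ hx (hfK0 x hxK)) hK.isClosed
  have hfc : HasCompactSupport f :=
    HasCompactSupport.of_support_subset_isCompact hK ((subset_tsupport f).trans hftsupp)
  have hflipW : IsLocLipschitzOn h f W := by
    refine isLocLipschitzOn_of_eqOn_of_eqOn h hW hK.isClosed hKW (isLocLipschitzOn_const h 0 W)
      (hv.sub h huW) (fun x hx ↦ hfW x hx) (fun x hx ↦ hfK0 x hx.2)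
  have hflip : IsLocLipschitzOn h f univ :=
    isLocLipschitzOn_of_eqOn_of_eqOn h hW hK.isClosed hKW (isLocLipschitzOn_const h 0 univ)
      (hv.sub h huW) (fun x hx ↦ hfW x hx) (fun x hx ↦ hfK0 x hx.2)
  have hfcont : Continuous f := hflip.continuous h
  have hψW : IsLocLipschitzOn h ψ W := isLocLipschitzOn_of_contMDiffOn h hW hψ1
  have hinvW : IsLocLipschitzOn h (fun x ↦ (ψ x)⁻¹) W := hψW.inv_of_pos h hW hψpos
  set w : X → ℝ := fun x ↦ f x * (ψ x)⁻¹ with hw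
  have hwlip : IsLocLipschitzOn h w univ :=
    isLocLipschitzOn_of_eqOn_of_eqOn h hW hK.isClosed hKW (isLocLipschitzOn_const h 0 univ)
      (hflipW.mul h hinvW) (fun x _ ↦ rfl) (fun x hx ↦ by simp [hw, hfK0 x hx.2])
  have hwc : HasCompactSupport w := hfc.mul_right
  have hwtsupp : tsupport w ⊆ K :=
    (tsupport_mul_subset_left (f := f) (g := fun x ↦ (ψ x)⁻¹)).trans hftsupp
  have hwcont : Continuous w := hwlip.continuous h
  have hwK0 : ∀ x ∉ K, w x = 0 := fun x hx ↦ by simp [hw, hfK0 x hx]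
  -- (2) Green's identity against `w`
  have hG := integral_mul_dalembertian_eq_neg_integral_innerDual_of_isLocLipschitzOn h hwlip hwc hu
  -- (3) the quotient rule: `h⁻¹(dw, du) = h⁻¹(df, du)/ψ − f h⁻¹(dψ, du)/ψ²` a.e.
  have hΔc : Continuous ((ofRiemannian h).dalembertian u) := continuous_dalembertian _ hu
  set A' : X → ℝ := fun x ↦ (ofRiemannian h).innerDual x (mvfderiv (𝓡 3) f x).toLinearMap
      (mvfderiv (𝓡 3) u x).toLinearMap * (ψ x)⁻¹ with hA'
  set P : X → ℝ := fun x ↦ f x * ((ψ x)⁻¹ * (ψ x)⁻¹) *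
      (ofRiemannian h).innerDual x (mvfderiv (𝓡 3) ψ x).toLinearMap
        (mvfderiv (𝓡 3) u x).toLinearMap with hP
  have hE1 : ∀ᵐ x ∂μ, (ofRiemannian h).innerDual x (mvfderiv (𝓡 3) w x).toLinearMap
      (mvfderiv (𝓡 3) u x).toLinearMap = A' x - P x := by
    filter_upwards [hflip.ae_mdifferentiableAt h isOpen_univ] with x hx
    have hfx := hx (mem_univ x)
    by_cases hxW : x ∈ W
    · have hψx : MDifferentiableAt (𝓡 3) 𝓘(ℝ, ℝ) ψ x :=
        (hψ1.contMDiffAt (hW.mem_nhds hxW)).mdifferentiableAt one_ne_zero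
      have hψxne := hψne x hxW
      have hlin : (mvfderiv (𝓡 3) w x).toLinearMap =
          (ψ x)⁻¹ • (mvfderiv (𝓡 3) f x).toLinearMap +
          (-(f x * ((ψ x)⁻¹ * (ψ x)⁻¹))) • (mvfderiv (𝓡 3) ψ x).toLinearMap := by
        apply LinearMap.ext
        intro ξ
        simp only [LinearMap.add_apply, LinearMap.smul_apply, smul_eq_mul,
          ContinuousLinearMap.coe_coe]
        have hq := mvfderiv_div_apply_of_ne hfx hψx hψc.continuousAt hψxne ξ
        rw [show (mvfderiv (𝓡 3) w x) ξ = mvfderiv (𝓡 3) (fun y ↦ f y * (ψ y)⁻¹) x ξ from rfl, hq]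
        field_simp
        ring
      rw [hlin, innerDual_add_left, innerDual_smul_left', innerDual_smul_left', hA', hP]
      ring
    · have hxK : x ∉ K := fun h' ↦ hxW (hKW h')
      have hdw : mvfderiv (𝓡 3) w x = 0 :=
        mvfderiv_eq_zero_of_notMem_tsupport fun h' ↦ hxK (hwtsupp h')
      have hdf : mvfderiv (𝓡 3) f x = 0 :=
        mvfderiv_eq_zero_of_notMem_tsupport fun h' ↦ hxK (hftsupp h')
      simp only [hA', hP, hdw, hdf, hfK0 x hxK, zero_mul, sub_zero]
      simp [PseudoRiemannianMetric.innerDual]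
  -- (4) integrability
  have hI_dw := integrable_innerDual_of_hasCompactSupport h hwlip hwc hu1
  have hI_df := integrable_innerDual_of_hasCompactSupport h hflip hfc hu1
  -- `ψ⁻¹` is bounded on `K`
  obtain ⟨m, hm, hmK⟩ : ∃ m : ℝ, 0 < m ∧ ∀ x ∈ K, m ≤ ψ x := by
    by_cases hKe : K.Nonempty
    · obtain ⟨x₀, hx₀, hmin⟩ := hK.exists_isMinOn hKe hψc.continuousOn
      exact ⟨ψ x₀, hψpos x₀ (hKW hx₀), fun x hx ↦ hmin hx⟩
    · exact ⟨1, one_pos, fun x hx ↦ absurd ⟨x, hx⟩ hKe⟩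
  have hA'eq : A' = fun x ↦ (ofRiemannian h).innerDual x (mvfderiv (𝓡 3) f x).toLinearMap
      (mvfderiv (𝓡 3) u x).toLinearMap * min ((ψ x)⁻¹) m⁻¹ := by
    funext x
    rw [hA']
    by_cases hxK : x ∈ K
    · rw [min_eq_left (inv_anti₀ hm (hmK x hxK))]
    · have hdf : mvfderiv (𝓡 3) f x = 0 :=
        mvfderiv_eq_zero_of_notMem_tsupport fun h' ↦ hxK (hftsupp h')
      simp only [hdf]
      simp [PseudoRiemannianMetric.innerDual]
  have hI_A : Integrable A' μ := by
    rw [hA'eq]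
    refine hI_df.mul_bdd ?_ (c := m⁻¹) (Eventually.of_forall fun x ↦ ?_)
    · exact ((hψc.measurable.inv).min measurable_const).aestronglyMeasurable
    · rw [Real.norm_eq_abs, abs_le]
      constructor
      · have : 0 ≤ min (ψ x)⁻¹ m⁻¹ := le_min (inv_nonneg.2 (by rw [hψ x]; exact hg0 x))
          (inv_nonneg.2 hm.le)
        linarith [inv_nonneg.2 hm.le]
      · exact min_le_right _ _
  have hI_P : Integrable P μ := by
    have : P =ᵐ[μ] fun x ↦ A' x - (ofRiemannian h).innerDual x (mvfderiv (𝓡 3) w x).toLinearMap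
        (mvfderiv (𝓡 3) u x).toLinearMap := by
      filter_upwards [hE1] with x hx
      rw [hx]; ring
    exact (hI_A.sub hI_dw).congr this.symm
  have hI_wΔ : Integrable (fun x ↦ w x * (ofRiemannian h).dalembertian u x) μ :=
    (hwcont.mul hΔc).integrable_of_hasCompactSupport hwc.mul_right
  -- (5) `A := ∫ h⁻¹(df, du)/ψ = −∫ w Δu + ∫ P`
  have hE2 : ∫ x, A' x ∂μ = -(∫ x, w x * (ofRiemannian h).dalembertian u x ∂μ) + ∫ x, P x ∂μ := by
    have h1 : ∫ x, (ofRiemannian h).innerDual x (mvfderiv (𝓡 3) w x).toLinearMap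
        (mvfderiv (𝓡 3) u x).toLinearMap ∂μ = (∫ x, A' x ∂μ) - ∫ x, P x ∂μ := by
      rw [integral_congr_ae hE1, integral_sub hI_A hI_P]
    rw [h1] at hG
    linarith
  -- (6) the pointwise calibration inequality, a.e. on `K`
  have hE3 : ∀ᵐ x ∂μ, x ∈ K → gradNorm h u x + A' x ≤ gradNorm h v x := by
    filter_upwards [hv.ae_mdifferentiableAt h hW] with x hvx hxK
    have hxW := hKW hxK
    have hvd := hvx hxW
    have hud : MDifferentiableAt (𝓡 3) 𝓘(ℝ, ℝ) u x := hu1.mdifferentiableAt one_ne_zero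
    -- `df = dv - du` at `x`
    have hfev : f =ᶠ[𝓝 x] fun y ↦ v y - u y := by
      filter_upwards [hW.mem_nhds hxW] with y hy using hfW y hy
    have hsplit : (ofRiemannian h).innerDual x (mvfderiv (𝓡 3) f x).toLinearMap
        (mvfderiv (𝓡 3) u x).toLinearMap =
        (ofRiemannian h).innerDual x (mvfderiv (𝓡 3) v x).toLinearMap
          (mvfderiv (𝓡 3) u x).toLinearMap -
        (ofRiemannian h).innerDual x (mvfderiv (𝓡 3) u x).toLinearMap
          (mvfderiv (𝓡 3) u x).toLinearMap := by
      simp only [PseudoRiemannianMetric.innerDual]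
      set s := (ofRiemannian h).sharp x (mvfderiv (𝓡 3) u x).toLinearMap
      change mvfderiv (𝓡 3) f x s = mvfderiv (𝓡 3) v x s - mvfderiv (𝓡 3) u x s
      rw [mvfderiv_congr_of_eventuallyEq hfev, mvfderiv_sub_apply hvd hud]
    have hCS := innerDual_le_gradNorm_mul_gradNorm h v u x
    have hself := innerDual_self_eq_gradNorm_sq h u x
    have hψx := hψpos x hxW
    have hgv := gradNorm_nonneg h v x
    have hψu : ψ x = gradNorm h u x := hψ x
    -- `h⁻¹(dv,du)/ψ ≤ |∇v|` and `|∇u|²/ψ = |∇u|`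
    have h1 : (ofRiemannian h).innerDual x (mvfderiv (𝓡 3) v x).toLinearMap
        (mvfderiv (𝓡 3) u x).toLinearMap * (ψ x)⁻¹ ≤ gradNorm h v x := by
      rw [← div_eq_mul_inv, div_le_iff₀ hψx, hψu]
      exact hCS
    have h2 : gradNorm h u x ^ 2 * (ψ x)⁻¹ = gradNorm h u x := by
      rw [hψu, sq, mul_assoc, mul_inv_cancel₀ (hψu ▸ hψx.ne'), mul_one]
    rw [hA']
    simp only
    rw [hsplit, sub_mul, hself, h2]
    linarith
  -- (7) integrate over `K`
  have hIv : IntegrableOn (gradNorm h v) K μ := hv.integrableOn_gradNorm h hW hK hKW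
  have hIu : IntegrableOn (gradNorm h u) K μ := huW.integrableOn_gradNorm h hW hK hKW
  have hIAK : IntegrableOn A' K μ := hI_A.integrableOn
  have hI12 : IntegrableOn (fun x ↦ gradNorm h u x + A' x) K μ := hIu.add hIAK
  have hstep1 : (∫ x in K, gradNorm h u x ∂μ) + (∫ x in K, A' x ∂μ) ≤ ∫ x in K, gradNorm h v x ∂μ := by
    have hmono := integral_mono_ae hI12 hIv
      ((ae_restrict_iff' hK.measurableSet).2 (hE3.mono fun x hx hxK ↦ hx hxK))
    rw [integral_add hIu hIAK] at hmono
    exact hmono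
  -- the `A'`, `w Δu` and `P` integrals live on `K`
  have hAK : ∫ x in K, A' x ∂μ = ∫ x, A' x ∂μ := by
    refine setIntegral_eq_integral_of_forall_compl_eq_zero fun x hx ↦ ?_
    rw [hA']
    simp only
    rw [mvfderiv_eq_zero_of_notMem_tsupport fun h' ↦ hx (hftsupp h')]
    simp [PseudoRiemannianMetric.innerDual]
  have hwΔK : ∫ x, w x * (ofRiemannian h).dalembertian u x ∂μ =
      ∫ x in K, w x * (ofRiemannian h).dalembertian u x ∂μ :=
    (setIntegral_eq_integral_of_forall_compl_eq_zero fun x hx ↦ by rw [hwK0 x hx, zero_mul]).symm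
  have hPK : ∫ x, P x ∂μ = ∫ x in K, P x ∂μ :=
    (setIntegral_eq_integral_of_forall_compl_eq_zero fun x hx ↦ by
      rw [hP]; simp only; rw [hfK0 x hx]; ring).symm
  -- (8) the correction term on `K`: `(v - u) ψ⁻² (ψ³ − E) = f ψ − w Δu + P` pointwise on `K`
  have hIfψ : IntegrableOn (fun x ↦ f x * ψ x) K μ :=
    ((hfcont.mul hψc).integrable_of_hasCompactSupport hfc.mul_right).integrableOn
  have hIwΔK : IntegrableOn (fun x ↦ w x * (ofRiemannian h).dalembertian u x) K μ :=
    hI_wΔ.integrableOn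
  have hIPK : IntegrableOn P K μ := hI_P.integrableOn
  have hcorr : ∫ x in K, (v x - u x) * (ψ x)⁻¹ ^ 2 *
      (ψ x ^ 3 - (ψ x * (ofRiemannian h).dalembertian u x -
        (ofRiemannian h).innerDual x (mvfderiv (𝓡 3) ψ x).toLinearMap
          (mvfderiv (𝓡 3) u x).toLinearMap)) ∂μ =
      (∫ x in K, f x * ψ x ∂μ) - (∫ x in K, w x * (ofRiemannian h).dalembertian u x ∂μ) +
        ∫ x in K, P x ∂μ := by
    have hIsub : IntegrableOn (fun x ↦ f x * ψ x - w x * (ofRiemannian h).dalembertian u x) K μ :=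
      hIfψ.sub hIwΔK
    rw [← integral_sub hIfψ hIwΔK, ← integral_add hIsub hIPK]
    refine setIntegral_congr_fun hK.measurableSet fun x hx ↦ ?_
    have hxW := hKW hx
    have hψx := hψne x hxW
    rw [hw, hP]
    simp only
    rw [hfW x hxW]
    field_simp
    ring
  -- (9) assemble: `J(v) − J(u) = ∫_K |∇v| − |∇u| + (v − u)|∇u|`
  have hJu : imcfEnergy h u K u = (∫ x in K, gradNorm h u x ∂μ) +
      ∫ x in K, u x * gradNorm h u x ∂μ := imcfEnergy_eq_integral_add h huW huW hW hK hKW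
  have hJv : imcfEnergy h u K v = (∫ x in K, gradNorm h v x ∂μ) +
      ∫ x in K, v x * gradNorm h u x ∂μ := imcfEnergy_eq_integral_add h huW hv hW hK hKW
  have hIug : IntegrableOn (fun x ↦ u x * gradNorm h u x) K μ :=
    huW.integrableOn_mul_gradNorm h hW hK hKW ((huW.continuousOn h).mono hKW)
  have hIvg : IntegrableOn (fun x ↦ v x * gradNorm h u x) K μ :=
    huW.integrableOn_mul_gradNorm h hW hK hKW ((hv.continuousOn h).mono hKW)
  have hfψK : ∫ x in K, f x * ψ x ∂μ =
      (∫ x in K, v x * gradNorm h u x ∂μ) - ∫ x in K, u x * gradNorm h u x ∂μ := by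
    rw [← integral_sub hIvg hIug]
    refine setIntegral_congr_fun hK.measurableSet fun x hx ↦ ?_
    rw [hfW x (hKW hx), hψ x]
    ring
  rw [hJu, hJv, hcorr, hfψK]
  rw [hAK, hE2, hwΔK, hPK] at hstep1
  linarith

/-- **Smooth Flow Lemma 2.3 (functional form): classical solutions of (∗∗) are weak solutions.**
If `u ∈ C²(X)` has `|∇u| > 0` and `|∇u| ∈ C¹` on the open set `W`, and solves the level-set equation
`div(∇u/|∇u|) = |∇u|` on `W` in the expanded classical form `ψ Δ_h u − h⁻¹(dψ, du) = ψ³`,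
`ψ = |∇u|`, then `u` is a weak solution of (1.5) on `W`. Huisken–Ilmanen state this for the
region `E_d ∖ Ē_c` foliated by a classical solution `(N_t)` of (∗), `u = t` on `N_t`, where
`div(∇u/|∇u|) = H_{N_t} = |∇u|`; together with Lemma 1.1 the printed conclusion "`E_t` minimizes
`J_u`" is this weak-solution property. [cite: HuiskenIlmanenIMCF2001, §2 Lemma 2.3] -/
theorem isWeakSolution_of_smooth {W : Set X} (hW : IsOpen W) {u : X → ℝ}
    (hu : ContMDiff (𝓡 3) 𝓘(ℝ, ℝ) 2 u) {ψ : X → ℝ} (hψ : ∀ x, ψ x = gradNorm h u x)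
    (hψpos : ∀ x ∈ W, 0 < ψ x) (hψ1 : ContMDiffOn (𝓡 3) 𝓘(ℝ, ℝ) 1 ψ W)
    (hpde : ∀ x ∈ W, ψ x * (ofRiemannian h).dalembertian u x -
      (ofRiemannian h).innerDual x (mvfderiv (𝓡 3) ψ x).toLinearMap
        (mvfderiv (𝓡 3) u x).toLinearMap = ψ x ^ 3) :
    IsWeakSolution h u W := by
  have hu1 : ContMDiff (𝓡 3) 𝓘(ℝ, ℝ) 1 u := hu.of_le (by norm_num)
  refine ⟨isLocLipschitzOn_of_contMDiff' h hu1 W, fun v hv K hK hKW hvK ↦ ?_⟩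
  have key := imcfEnergy_add_setIntegral_le_of_smooth h hW hu hψ hψpos hψ1 hv.1 hK hKW hvK
  have hzero : ∫ x in K, (v x - u x) * (ψ x)⁻¹ ^ 2 *
      (ψ x ^ 3 - (ψ x * (ofRiemannian h).dalembertian u x -
        (ofRiemannian h).innerDual x (mvfderiv (𝓡 3) ψ x).toLinearMap
          (mvfderiv (𝓡 3) u x).toLinearMap)) ∂riemannianMeasure h = 0 := by
    refine setIntegral_eq_zero_of_forall_eq_zero fun x hx ↦ ?_
    rw [hpde x (hKW hx), sub_self, mul_zero]
  linarith

/-- **Classical subsolutions are weak subsolutions.** If `u ∈ C²(X)` has `|∇u| > 0` and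
`|∇u| ∈ C¹` on the open set `W`, and its level sets move *at least as fast* as by inverse mean
curvature, `div(∇u/|∇u|) ≥ |∇u|` on `W` — in expanded form `ψ Δ_h u − h⁻¹(dψ, du) ≥ ψ³`,
`ψ = |∇u|` — then `u` is a weak subsolution of (1.5) on `W` (against competitors `v ≤ u` the
correction term `∫ (v − u) ψ⁻² (ψ³ − E)` of the calibration inequality is `≥ 0`). This is the
notion "smooth subsolution of (1.5)" of the proof of Thm. 3.1, step 2 ("`λ log s` is a smooth
subsolution … on `∂U_L × [C, ∞)`") and of Remark 1 after Thm. 3.1 ("`v = C log |x|` in the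
asymptotic region"). [cite: HuiskenIlmanenIMCF2001, §2 Lemma 2.3; §3 proof of Thm. 3.1 step 2 and Remark 1] -/
theorem isWeakSubsolution_of_smooth {W : Set X} (hW : IsOpen W) {u : X → ℝ}
    (hu : ContMDiff (𝓡 3) 𝓘(ℝ, ℝ) 2 u) {ψ : X → ℝ} (hψ : ∀ x, ψ x = gradNorm h u x)
    (hψpos : ∀ x ∈ W, 0 < ψ x) (hψ1 : ContMDiffOn (𝓡 3) 𝓘(ℝ, ℝ) 1 ψ W)
    (hpde : ∀ x ∈ W, ψ x ^ 3 ≤ ψ x * (ofRiemannian h).dalembertian u x -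
      (ofRiemannian h).innerDual x (mvfderiv (𝓡 3) ψ x).toLinearMap
        (mvfderiv (𝓡 3) u x).toLinearMap) :
    IsWeakSubsolution h u W := by
  have hu1 : ContMDiff (𝓡 3) 𝓘(ℝ, ℝ) 1 u := hu.of_le (by norm_num)
  refine ⟨isLocLipschitzOn_of_contMDiff' h hu1 W, fun v hv hle K hK hKW hvK ↦ ?_⟩
  have key := imcfEnergy_add_setIntegral_le_of_smooth h hW hu hψ hψpos hψ1 hv.1 hK hKW hvK
  have hnn : 0 ≤ ∫ x in K, (v x - u x) * (ψ x)⁻¹ ^ 2 *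
      (ψ x ^ 3 - (ψ x * (ofRiemannian h).dalembertian u x -
        (ofRiemannian h).innerDual x (mvfderiv (𝓡 3) ψ x).toLinearMap
          (mvfderiv (𝓡 3) u x).toLinearMap)) ∂riemannianMeasure h := by
    refine setIntegral_nonneg hK.measurableSet fun x hx ↦ ?_
    have h1 : v x - u x ≤ 0 := sub_nonpos.2 (hle x (hKW hx))
    have h2 : ψ x ^ 3 - (ψ x * (ofRiemannian h).dalembertian u x -
        (ofRiemannian h).innerDual x (mvfderiv (𝓡 3) ψ x).toLinearMap
          (mvfderiv (𝓡 3) u x).toLinearMap) ≤ 0 := sub_nonpos.2 (hpde x (hKW hx))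
    have h3 : 0 ≤ (ψ x)⁻¹ ^ 2 := sq_nonneg _
    have : 0 ≤ (-(v x - u x)) * (ψ x)⁻¹ ^ 2 * (-(ψ x ^ 3 - (ψ x * (ofRiemannian h).dalembertian u x -
        (ofRiemannian h).innerDual x (mvfderiv (𝓡 3) ψ x).toLinearMap
          (mvfderiv (𝓡 3) u x).toLinearMap))) :=
      mul_nonneg (mul_nonneg (by linarith) h3) (by linarith)
    linarith
  linarith

/-- **Classical supersolutions are weak supersolutions.** If `u ∈ C²(X)` has `|∇u| > 0` and
`|∇u| ∈ C¹` on the open set `W`, and `div(∇u/|∇u|) ≤ |∇u|` on `W` — in expanded form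
`ψ Δ_h u − h⁻¹(dψ, du) ≤ ψ³`, `ψ = |∇u|` — then `u` is a weak supersolution of (1.5) on `W`.
[cite: HuiskenIlmanenIMCF2001, §2 Lemma 2.3] -/
theorem isWeakSupersolution_of_smooth {W : Set X} (hW : IsOpen W) {u : X → ℝ}
    (hu : ContMDiff (𝓡 3) 𝓘(ℝ, ℝ) 2 u) {ψ : X → ℝ} (hψ : ∀ x, ψ x = gradNorm h u x)
    (hψpos : ∀ x ∈ W, 0 < ψ x) (hψ1 : ContMDiffOn (𝓡 3) 𝓘(ℝ, ℝ) 1 ψ W)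
    (hpde : ∀ x ∈ W, ψ x * (ofRiemannian h).dalembertian u x -
      (ofRiemannian h).innerDual x (mvfderiv (𝓡 3) ψ x).toLinearMap
        (mvfderiv (𝓡 3) u x).toLinearMap ≤ ψ x ^ 3) :
    IsWeakSupersolution h u W := by
  have hu1 : ContMDiff (𝓡 3) 𝓘(ℝ, ℝ) 1 u := hu.of_le (by norm_num)
  refine ⟨isLocLipschitzOn_of_contMDiff' h hu1 W, fun v hv hle K hK hKW hvK ↦ ?_⟩
  have key := imcfEnergy_add_setIntegral_le_of_smooth h hW hu hψ hψpos hψ1 hv.1 hK hKW hvK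
  have hnn : 0 ≤ ∫ x in K, (v x - u x) * (ψ x)⁻¹ ^ 2 *
      (ψ x ^ 3 - (ψ x * (ofRiemannian h).dalembertian u x -
        (ofRiemannian h).innerDual x (mvfderiv (𝓡 3) ψ x).toLinearMap
          (mvfderiv (𝓡 3) u x).toLinearMap)) ∂riemannianMeasure h := by
    refine setIntegral_nonneg hK.measurableSet fun x hx ↦ ?_
    have h1 : 0 ≤ v x - u x := sub_nonneg.2 (hle x (hKW hx))
    have h2 : 0 ≤ ψ x ^ 3 - (ψ x * (ofRiemannian h).dalembertian u x -
        (ofRiemannian h).innerDual x (mvfderiv (𝓡 3) ψ x).toLinearMap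
          (mvfderiv (𝓡 3) u x).toLinearMap) := sub_nonneg.2 (hpde x (hKW hx))
    exact mul_nonneg (mul_nonneg h1 (sq_nonneg _)) h2
  linarith

end Calibration

/-! ### Local hypotheses: `u` of class `C²` on `W` only -/

section LocalHypotheses

variable [T2Space X] [LocallyCompactSpace X] [MeasurableSpace X] [BorelSpace X]
  [SecondCountableTopology X] [(ofRiemannian h).HasLeviCivita]

omit [MeasurableSpace X] [BorelSpace X] [SecondCountableTopology X] [T2Space X]
  [LocallyCompactSpace X] in
/-- Locality of `hessianAux` (a file-local copy of the lemma of `MassCapacityHarmonic.lean`).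
[folklore] -/
private theorem hessianAux_congr_aux {f f' : X → ℝ} {x : X} (hf : f =ᶠ[𝓝 x] f')
    (Y Z : Π x : X, TangentSpace (𝓡 3) x) :
    (ofRiemannian h).hessianAux f Y Z x = (ofRiemannian h).hessianAux f' Y Z x := by
  have h1 : (fun y ↦ mvfderiv (𝓡 3) f y (Z y)) =ᶠ[𝓝 x] fun y ↦ mvfderiv (𝓡 3) f' y (Z y) := by
    filter_upwards [hf.eventuallyEq_nhds] with y hy
    rw [mvfderiv_congr_of_eventuallyEq hy]
  rw [PseudoRiemannianMetric.hessianAux, PseudoRiemannianMetric.hessianAux,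
    mvfderiv_congr_of_eventuallyEq h1, mvfderiv_congr_of_eventuallyEq hf]

omit [MeasurableSpace X] [BorelSpace X] [SecondCountableTopology X] [T2Space X]
  [LocallyCompactSpace X] in
/-- Locality of the Hessian (file-local copy of `hessian_congr_of_eventuallyEq` of
`MassCapacityHarmonic.lean`). [folklore] -/
private theorem hessian_congr_aux {f f' : X → ℝ} {x : X} (hf : f =ᶠ[𝓝 x] f') :
    (ofRiemannian h).hessian f x = (ofRiemannian h).hessian f' x := by
  have key : (fun (Y Z : Π x : X, TangentSpace (𝓡 3) x) ↦ (ofRiemannian h).hessianAux f Y Z x) =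
      fun Y Z ↦ (ofRiemannian h).hessianAux f' Y Z x := by
    funext Y Z
    exact hessianAux_congr_aux h hf Y Z
  unfold PseudoRiemannianMetric.hessian
  classical
  exact congrArg (fun A : (Π x : X, TangentSpace (𝓡 3) x) → (Π x : X, TangentSpace (𝓡 3) x) → ℝ ↦
    if h : ∃ B : LinearMap.BilinForm ℝ (TangentSpace (𝓡 3) x), ∀ X₀ Y₀ : TangentSpace (𝓡 3) x,
      B X₀ Y₀ = A (FiberBundle.extend E3 X₀) (FiberBundle.extend E3 Y₀) then h.choose else 0) key

omit [MeasurableSpace X] [BorelSpace X] [SecondCountableTopology X] [T2Space X]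
  [LocallyCompactSpace X] in
/-- **Locality of the Laplace–Beltrami operator** (file-local copy of
`dalembertian_congr_of_eventuallyEq` of `MassCapacityHarmonic.lean`). [folklore] -/
private theorem dalembertian_congr_aux {f f' : X → ℝ} {x : X} (hf : f =ᶠ[𝓝 x] f') :
    (ofRiemannian h).dalembertian f x = (ofRiemannian h).dalembertian f' x := by
  simp only [PseudoRiemannianMetric.dalembertian, hessian_congr_aux h hf]

omit [MeasurableSpace X] [BorelSpace X] [(ofRiemannian h).HasLeviCivita] in
/-- **Globalisation near a compact set** (the part of `exists_contMDiff_hasCompactSupport_eventuallyEq`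
of `MassCapacityHarmonic.lean` used here): a function `C^n` on an open `U ⊇ K`, `K` compact, agrees
near every point of an open `V`, `K ⊆ V ⊆ U`, with a `C^n` function on `X` (multiply by a smooth
bump equal to `1` near `K` and supported inside `U`). [folklore] -/
private theorem exists_contMDiff_eventuallyEq_aux {n : ℕ∞} {U K : Set X} (hU : IsOpen U)
    (hK : IsCompact K) (hKU : K ⊆ U) {φ₀ : X → ℝ} (hφ₀ : ContMDiffOn (𝓡 3) 𝓘(ℝ, ℝ) n φ₀ U) :
    ∃ f : X → ℝ, ContMDiff (𝓡 3) 𝓘(ℝ, ℝ) n f ∧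
      ∃ V : Set X, IsOpen V ∧ K ⊆ V ∧ V ⊆ U ∧ ∀ x ∈ V, f =ᶠ[𝓝 x] φ₀ := by
  obtain ⟨V₁, hV₁o, hKV₁, hV₁U, hV₁c⟩ := exists_open_between_and_isCompact_closure hK hU hKU
  obtain ⟨V₂, hV₂o, hV₁V₂, hV₂U, -⟩ := exists_open_between_and_isCompact_closure hV₁c hU hV₁U
  obtain ⟨η, hη0, hη1, -⟩ := exists_contMDiffMap_zero_one_of_isClosed (I := 𝓡 3) (n := (⊤ : ℕ∞))
    hV₂o.isClosed_compl isClosed_closure (disjoint_compl_left_iff.2 hV₁V₂)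
  set f : X → ℝ := fun p ↦ η p * φ₀ p with hf_def
  have hf0 : ∀ p, p ∉ V₂ → f p = 0 := fun p hp ↦ by
    simp only [hf_def, show η p = 0 from hη0 hp, zero_mul]
  refine ⟨f, fun p ↦ ?_, V₁, hV₁o, hKV₁, subset_closure.trans hV₁U, fun p hp ↦ ?_⟩
  · by_cases hp : p ∈ U
    · exact ((η.contMDiff.of_le (WithTop.coe_le_coe.mpr le_top)).contMDiffAt).mul
        (hφ₀.contMDiffAt (hU.mem_nhds hp))
    · have hp2 : p ∉ closure V₂ := fun h2 ↦ hp (hV₂U h2)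
      have hev : f =ᶠ[𝓝 p] fun _ ↦ 0 := by
        filter_upwards [isClosed_closure.isOpen_compl.mem_nhds hp2] with q hq
        exact hf0 q fun h2 ↦ hq (subset_closure h2)
      exact contMDiffAt_const.congr_of_eventuallyEq hev
  · filter_upwards [hV₁o.mem_nhds hp] with q hq
    simp only [hf_def, show η q = 1 from hη1 (subset_closure hq), one_mul]

set_option backward.isDefEq.respectTransparency false in
/-- **Calibration inequality, local hypotheses.** As `imcfEnergy_add_setIntegral_le_of_smooth`,
with `u` only of class `C²` on the open set `W` (and `ψ = |∇u|` only on `W`): for every `v`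
locally Lipschitz on `W` and compact `K ⊆ W` containing `{v ≠ u} ∩ W`,
`J_u^K(u) + ∫_K (v − u) ψ⁻² (ψ³ − E) dμ_h ≤ J_u^K(v)`, `E = ψ Δ_h u − h⁻¹(dψ, du)`. Proof: `u`
agrees near `K` with a `C²` function `ũ` on `X` (smooth cut-off), every quantity in the
inequality only sees `u` near `K`, and the global statement applies to `ũ` on a neighbourhood of
`K`. [cite: HuiskenIlmanenIMCF2001, §2 Lemma 2.3 and its proof] -/
theorem imcfEnergy_add_setIntegral_le_of_smoothOn {W : Set X} (hW : IsOpen W) {u : X → ℝ}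
    (hu : ContMDiffOn (𝓡 3) 𝓘(ℝ, ℝ) 2 u W) {ψ : X → ℝ} (hψ : ∀ x ∈ W, ψ x = gradNorm h u x)
    (hψpos : ∀ x ∈ W, 0 < ψ x) (hψ1 : ContMDiffOn (𝓡 3) 𝓘(ℝ, ℝ) 1 ψ W)
    {v : X → ℝ} (hv : IsLocLipschitzOn h v W) {K : Set X} (hK : IsCompact K) (hKW : K ⊆ W)
    (hvK : {x | x ∈ W ∧ v x ≠ u x} ⊆ K) :
    imcfEnergy h u K u + ∫ x in K, (v x - u x) * (ψ x)⁻¹ ^ 2 *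
        (ψ x ^ 3 - (ψ x * (ofRiemannian h).dalembertian u x -
          (ofRiemannian h).innerDual x (mvfderiv (𝓡 3) ψ x).toLinearMap
            (mvfderiv (𝓡 3) u x).toLinearMap)) ∂riemannianMeasure h ≤
      imcfEnergy h u K v := by
  -- globalise `u` near `K`
  obtain ⟨U, hU2, V, hVo, hKV, hVW, hUeq⟩ := exists_contMDiff_eventuallyEq_aux hW hK hKW hu
  have hUeq' : ∀ x ∈ V, U x = u x := fun x hx ↦ (hUeq x hx).eq_of_nhds
  have hgrad : ∀ x ∈ V, gradNorm h U x = gradNorm h u x := fun x hx ↦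
    gradNorm_congr_of_eventuallyEq h (hUeq x hx)
  set Ψ : X → ℝ := gradNorm h U with hΨ
  have hΨev : ∀ x ∈ V, Ψ =ᶠ[𝓝 x] ψ := by
    intro x hx
    filter_upwards [hVo.mem_nhds hx] with y hy
    rw [hgrad y hy, hψ y (hVW hy)]
  have hΨeq : ∀ x ∈ V, Ψ x = ψ x := fun x hx ↦ (hΨev x hx).eq_of_nhds
  have hΨpos : ∀ x ∈ V, 0 < Ψ x := fun x hx ↦ by rw [hΨeq x hx]; exact hψpos x (hVW hx)
  have hΨ1 : ContMDiffOn (𝓡 3) 𝓘(ℝ, ℝ) 1 Ψ V :=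
    (hψ1.mono hVW).congr fun x hx ↦ hΨeq x hx
  -- the global statement for `U` on `V`
  have hvV : IsLocLipschitzOn h v V := hv.mono h hVW
  have hvK' : {x | x ∈ V ∧ v x ≠ U x} ⊆ K := by
    intro x hx
    exact hvK ⟨hVW hx.1, by rw [← hUeq' x hx.1]; exact hx.2⟩
  have key := imcfEnergy_add_setIntegral_le_of_smooth h hVo hU2 (fun x ↦ rfl) hΨpos hΨ1 hvV hK
    hKV hvK'
  -- translate back to `u`
  have hE1 : imcfEnergy h U K U = imcfEnergy h u K u := by
    rw [imcfEnergy_congr_left h hVo (fun x hx ↦ hUeq' x hx) hK hKV,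
      imcfEnergy_congr_of_eqOn h hVo hK hKV (fun x hx ↦ hUeq' x hx)]
  have hE2 : imcfEnergy h U K v = imcfEnergy h u K v :=
    imcfEnergy_congr_left h hVo (fun x hx ↦ hUeq' x hx) hK hKV v
  have hE3 : ∫ x in K, (v x - U x) * (Ψ x)⁻¹ ^ 2 *
      (Ψ x ^ 3 - (Ψ x * (ofRiemannian h).dalembertian U x -
        (ofRiemannian h).innerDual x (mvfderiv (𝓡 3) Ψ x).toLinearMap
          (mvfderiv (𝓡 3) U x).toLinearMap)) ∂riemannianMeasure h =
      ∫ x in K, (v x - u x) * (ψ x)⁻¹ ^ 2 *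
        (ψ x ^ 3 - (ψ x * (ofRiemannian h).dalembertian u x -
          (ofRiemannian h).innerDual x (mvfderiv (𝓡 3) ψ x).toLinearMap
            (mvfderiv (𝓡 3) u x).toLinearMap)) ∂riemannianMeasure h := by
    refine setIntegral_congr_fun hK.measurableSet fun x hx ↦ ?_
    have hxV := hKV hx
    rw [hUeq' x hxV, hΨeq x hxV, dalembertian_congr_aux h (hUeq x hxV),
      mvfderiv_congr_of_eventuallyEq (hΨev x hxV), mvfderiv_congr_of_eventuallyEq (hUeq x hxV)]
  rw [hE1, hE2, hE3] at key
  exact key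

/-- **Smooth Flow Lemma 2.3, local hypotheses**: if `u` is `C²` on the open set `W` with
`|∇u| > 0`, `|∇u| ∈ C¹` on `W`, and solves `div(∇u/|∇u|) = |∇u|` there (expanded form
`ψ Δ_h u − h⁻¹(dψ, du) = ψ³`, `ψ = |∇u|` on `W`), then `u` is a weak solution of (1.5) on `W` —
e.g. `u = (n − 1) log |x|` on `ℝⁿ ∖ {0}` (expanding spheres, (0.3)).
[cite: HuiskenIlmanenIMCF2001, §2 Lemma 2.3] -/
theorem isWeakSolution_of_smoothOn {W : Set X} (hW : IsOpen W) {u : X → ℝ}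
    (hu : ContMDiffOn (𝓡 3) 𝓘(ℝ, ℝ) 2 u W) {ψ : X → ℝ} (hψ : ∀ x ∈ W, ψ x = gradNorm h u x)
    (hψpos : ∀ x ∈ W, 0 < ψ x) (hψ1 : ContMDiffOn (𝓡 3) 𝓘(ℝ, ℝ) 1 ψ W)
    (hpde : ∀ x ∈ W, ψ x * (ofRiemannian h).dalembertian u x -
      (ofRiemannian h).innerDual x (mvfderiv (𝓡 3) ψ x).toLinearMap
        (mvfderiv (𝓡 3) u x).toLinearMap = ψ x ^ 3) :
    IsWeakSolution h u W := by
  refine ⟨isLocLipschitzOn_of_contMDiffOn h hW (hu.of_le (by norm_num)),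
    fun v hv K hK hKW hvK ↦ ?_⟩
  have key := imcfEnergy_add_setIntegral_le_of_smoothOn h hW hu hψ hψpos hψ1 hv.1 hK hKW hvK
  have hzero : ∫ x in K, (v x - u x) * (ψ x)⁻¹ ^ 2 *
      (ψ x ^ 3 - (ψ x * (ofRiemannian h).dalembertian u x -
        (ofRiemannian h).innerDual x (mvfderiv (𝓡 3) ψ x).toLinearMap
          (mvfderiv (𝓡 3) u x).toLinearMap)) ∂riemannianMeasure h = 0 := by
    refine setIntegral_eq_zero_of_forall_eq_zero fun x hx ↦ ?_
    rw [hpde x (hKW hx), sub_self, mul_zero]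
  linarith

/-- **Classical subsolutions (`C²` on `W`) are weak subsolutions**: `div(∇u/|∇u|) ≥ |∇u|` on
`W` in the expanded form `ψ Δ_h u − h⁻¹(dψ, du) ≥ ψ³`, `ψ = |∇u| > 0`, `ψ ∈ C¹` on `W`, for `u`
of class `C²` on `W` — e.g. `C log |x|`, `C ≤ n − 1`, in the asymptotic region (Remark 1 after
Thm. 3.1), or `λ log s` on a cone (proof of Thm. 3.1, step 2).
[cite: HuiskenIlmanenIMCF2001, §2 Lemma 2.3; §3 Thm. 3.1 Remark 1 and proof step 2] -/
theorem isWeakSubsolution_of_smoothOn {W : Set X} (hW : IsOpen W) {u : X → ℝ}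
    (hu : ContMDiffOn (𝓡 3) 𝓘(ℝ, ℝ) 2 u W) {ψ : X → ℝ} (hψ : ∀ x ∈ W, ψ x = gradNorm h u x)
    (hψpos : ∀ x ∈ W, 0 < ψ x) (hψ1 : ContMDiffOn (𝓡 3) 𝓘(ℝ, ℝ) 1 ψ W)
    (hpde : ∀ x ∈ W, ψ x ^ 3 ≤ ψ x * (ofRiemannian h).dalembertian u x -
      (ofRiemannian h).innerDual x (mvfderiv (𝓡 3) ψ x).toLinearMap
        (mvfderiv (𝓡 3) u x).toLinearMap) :
    IsWeakSubsolution h u W := by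
  refine ⟨isLocLipschitzOn_of_contMDiffOn h hW (hu.of_le (by norm_num)),
    fun v hv hle K hK hKW hvK ↦ ?_⟩
  have key := imcfEnergy_add_setIntegral_le_of_smoothOn h hW hu hψ hψpos hψ1 hv.1 hK hKW hvK
  have hnn : 0 ≤ ∫ x in K, (v x - u x) * (ψ x)⁻¹ ^ 2 *
      (ψ x ^ 3 - (ψ x * (ofRiemannian h).dalembertian u x -
        (ofRiemannian h).innerDual x (mvfderiv (𝓡 3) ψ x).toLinearMap
          (mvfderiv (𝓡 3) u x).toLinearMap)) ∂riemannianMeasure h := by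
    refine setIntegral_nonneg hK.measurableSet fun x hx ↦ ?_
    have h1 : v x - u x ≤ 0 := sub_nonpos.2 (hle x (hKW hx))
    have h2 : ψ x ^ 3 - (ψ x * (ofRiemannian h).dalembertian u x -
        (ofRiemannian h).innerDual x (mvfderiv (𝓡 3) ψ x).toLinearMap
          (mvfderiv (𝓡 3) u x).toLinearMap) ≤ 0 := sub_nonpos.2 (hpde x (hKW hx))
    have : 0 ≤ (-(v x - u x)) * (ψ x)⁻¹ ^ 2 * (-(ψ x ^ 3 - (ψ x * (ofRiemannian h).dalembertian u x -
        (ofRiemannian h).innerDual x (mvfderiv (𝓡 3) ψ x).toLinearMap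
          (mvfderiv (𝓡 3) u x).toLinearMap))) :=
      mul_nonneg (mul_nonneg (by linarith) (sq_nonneg _)) (by linarith)
    linarith
  linarith

/-- **Classical supersolutions (`C²` on `W`) are weak supersolutions**:
`ψ Δ_h u − h⁻¹(dψ, du) ≤ ψ³` on `W`. [cite: HuiskenIlmanenIMCF2001, §2 Lemma 2.3] -/
theorem isWeakSupersolution_of_smoothOn {W : Set X} (hW : IsOpen W) {u : X → ℝ}
    (hu : ContMDiffOn (𝓡 3) 𝓘(ℝ, ℝ) 2 u W) {ψ : X → ℝ} (hψ : ∀ x ∈ W, ψ x = gradNorm h u x)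
    (hψpos : ∀ x ∈ W, 0 < ψ x) (hψ1 : ContMDiffOn (𝓡 3) 𝓘(ℝ, ℝ) 1 ψ W)
    (hpde : ∀ x ∈ W, ψ x * (ofRiemannian h).dalembertian u x -
      (ofRiemannian h).innerDual x (mvfderiv (𝓡 3) ψ x).toLinearMap
        (mvfderiv (𝓡 3) u x).toLinearMap ≤ ψ x ^ 3) :
    IsWeakSupersolution h u W := by
  refine ⟨isLocLipschitzOn_of_contMDiffOn h hW (hu.of_le (by norm_num)),
    fun v hv hle K hK hKW hvK ↦ ?_⟩
  have key := imcfEnergy_add_setIntegral_le_of_smoothOn h hW hu hψ hψpos hψ1 hv.1 hK hKW hvK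
  have hnn : 0 ≤ ∫ x in K, (v x - u x) * (ψ x)⁻¹ ^ 2 *
      (ψ x ^ 3 - (ψ x * (ofRiemannian h).dalembertian u x -
        (ofRiemannian h).innerDual x (mvfderiv (𝓡 3) ψ x).toLinearMap
          (mvfderiv (𝓡 3) u x).toLinearMap)) ∂riemannianMeasure h := by
    refine setIntegral_nonneg hK.measurableSet fun x hx ↦ ?_
    exact mul_nonneg (mul_nonneg (sub_nonneg.2 (hle x (hKW hx))) (sq_nonneg _))
      (sub_nonneg.2 (hpde x (hKW hx)))
  linarith

end LocalHypotheses

end Literature.Geometry.Lorentzian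

end
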